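import Literature.Topology.FourManifolds.RegularSublevelSet
import HarnessLib

/-!
# Milnor 1965, Lemma 2.9 with the Morse data, for a function Morse only near the sublevel set

Topic `Literature/Topology/FourManifolds` (fact seat
`provefact-Literature.Topology.FourManifolds.exists-68ee520c9a`, Wall 1964, Lemma 2,
`WallBoundingHandlebody.lean`; item 6 of the route recorded there: the handlebody
`H = {F ≤ κ}` of a spliced function `F` on `W` which is a Morse function near `H` but merely
smooth — indeed constant — near `∂W`).  Everything here is **proved**; no named facts.

`sublevel_morseData_local` is the tree's `sublevel_morseData` (`RegularSublevelSet.lean`,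
Milnor 1965, Lemma 2.9: a regular sublevel set `S = {f ≤ a}` in the interior is a smooth
manifold with boundary `{f = a}`, smoothly embedded, and `f|_S + (1 − a)` is a Morse function
adapted to `∂S` with the critical points and indices of `f`) with the global hypothesis
"`f` is a Morse function adapted to `∂M`" replaced by what the proof uses: `f` is smooth, the
sublevel set lies in the interior, the level `a` is non-critical, and the Hessian of `f` is
nondegenerate at the critical points of `f` IN `S`.  The proof is the tree's, verbatim up to the
sourcing of these three facts.

## References

* J. Milnor, *Lectures on the h-cobordism theorem* (1965), Lemma 2.9 (PDF p. 11) and Def. 3.1.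
  [MilnorHCobordism1965]
* C. T. C. Wall, *On simply-connected 4-manifolds*, J. London Math. Soc. 39 (1964), proof of
  Lemma 2 (p. 144). [WallJLMS1964]
-/

open scoped Manifold ContDiff Topology
open Set Function

noncomputable section

universe u

namespace Literature.Topology.FourManifolds

/-- Local notation: `ℍ n` is the model half-space `EuclideanHalfSpace n`. -/
local notation "ℍ " n:arg => EuclideanHalfSpace n

section SublevelMorseLocal

variable {k : ℕ} {M : Type u} [TopologicalSpace M] [ChartedSpace (ℍ (k + 1)) M]
  [IsManifold (𝓡∂ (k + 1)) ∞ M]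

/-- **Milnor 1965, Lemma 2.9, with the Morse data, local hypotheses** (dimension `k + 1 ≥ 2`).
Let `f : M → ℝ` be smooth, `a` a level such that `{f ≤ a}` lies in the interior of `M`, no
critical point of `f` lies on `{f = a}`, and the Hessian of `f` is nondegenerate at every
critical point in `{f ≤ a}`.  With the structure `sublevelAtlas` on `S = {f ≤ a}` (a `C^∞`
manifold with boundary `{f = a}`): the inclusion is a smooth embedding, `f|_S + (1 - a)` is a
Morse function adapted to `∂S`, its critical points are those of `f` in `S`, with the same
indices.  (The tree's `sublevel_morseData` assumes `f` Morse and adapted to `∂M` globally and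
derives the three local facts from that; the proof below is otherwise the same.)
[cite: MilnorHCobordism1965, Lemma 2.9 (PDF p. 11)] -/
theorem sublevel_morseData_local (hk : 1 ≤ k) {f : M → ℝ}
    (hsmooth : ContMDiff (𝓡∂ (k + 1)) 𝓘(ℝ, ℝ) ∞ f) {a : ℝ}
    (hint : ∀ p, f p ≤ a → (𝓡∂ (k + 1)).IsInteriorPoint p)
    (hreg : ∀ z, IsMCriticalPt (𝓡∂ (k + 1)) f z → f z ≠ a)
    (hnondeg : ∀ z, f z ≤ a → IsMCriticalPt (𝓡∂ (k + 1)) f z →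
      (mhessian (𝓡∂ (k + 1)) f z).Nondegenerate) :
    ∃ (hreg' : ∀ p, f p = a → ¬ IsMCriticalPt (𝓡∂ (k + 1)) f p),
      letI := (sublevelAtlas hsmooth a hint hreg').chartedSpace
      IsManifold (𝓡∂ (k + 1)) ∞ ↥(f ⁻¹' Iic a) ∧
      Manifold.IsSmoothEmbedding (𝓡∂ (k + 1)) (𝓡∂ (k + 1)) ∞ (Subtype.val : ↥(f ⁻¹' Iic a) → M) ∧
      IsMorseAdapted (𝓡∂ (k + 1)) (fun x : ↥(f ⁻¹' Iic a) => f x + (1 - a)) ∧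
      (∀ x : ↥(f ⁻¹' Iic a),
        IsMCriticalPt (𝓡∂ (k + 1)) (fun x : ↥(f ⁻¹' Iic a) => f x + (1 - a)) x ↔
          IsMCriticalPt (𝓡∂ (k + 1)) f x.1) ∧
      (∀ x : ↥(f ⁻¹' Iic a), IsMCriticalPt (𝓡∂ (k + 1)) f x.1 →
        morseIndex (𝓡∂ (k + 1)) (fun x : ↥(f ⁻¹' Iic a) => f x + (1 - a)) x =
          morseIndex (𝓡∂ (k + 1)) f x.1) ∧
      (∀ x : ↥(f ⁻¹' Iic a), (𝓡∂ (k + 1)).IsBoundaryPoint x ↔ f x.1 = a) := by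
  have hreg' : ∀ p, f p = a → ¬ IsMCriticalPt (𝓡∂ (k + 1)) f p := fun p hp hc => hreg p hc hp
  refine ⟨hreg', ?_⟩
  set Φ := sublevelAtlas hsmooth a hint hreg' with hΦ
  letI := Φ.chartedSpace
  haveI := Φ.isManifold
  set F : M → ℝ := fun y => f y + (1 - a) with hFdef
  have hg : (fun x : ↥(f ⁻¹' Iic a) => f x + (1 - a)) = F ∘ Subtype.val := rfl
  have hFsmooth : ContMDiff (𝓡∂ (k + 1)) 𝓘(ℝ, ℝ) ∞ F :=
    ((contDiff_id.add contDiff_const : ContDiff ℝ ∞ fun t : ℝ => t + (1 - a))).comp_contMDiff hsmooth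
  have hval : ContMDiff (𝓡∂ (k + 1)) (𝓡∂ (k + 1)) ∞ (Subtype.val : ↥(f ⁻¹' Iic a) → M) :=
    Φ.contMDiff_subtype_val hk
  have hgsmooth : ContMDiff (𝓡∂ (k + 1)) 𝓘(ℝ, ℝ) ∞ (F ∘ Subtype.val) := hFsmooth.comp hval
  -- `F ∘ Θ.symm` is smooth on the (open) target of every half-slice chart
  have hFΘ : ∀ p : ↥(f ⁻¹' Iic a), ContDiffOn ℝ ∞ (F ∘ (Φ.datum p).Θ.symm) (Φ.datum p).Θ.target :=
    fun p => contMDiffOn_iff_contDiffOn.1 (hFsmooth.comp_contMDiffOn (Φ.datum p).contMDiffOn_symm)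
  have hz₀ : ∀ p : ↥(f ⁻¹' Iic a), (Φ.datum p).Θ p.1 ∈ (Φ.datum p).Θ.target := fun p =>
    (Φ.datum p).Θ.map_source (Φ.mem_source p)
  have hFΘd : ∀ p : ↥(f ⁻¹' Iic a),
      DifferentiableAt ℝ (F ∘ (Φ.datum p).Θ.symm) ((Φ.datum p).Θ p.1) := fun p =>
    ((hFΘ p _ (hz₀ p)).contDiffAt ((Φ.datum p).Θ.open_target.mem_nhds (hz₀ p))).differentiableAt
      (by simp)
  -- criticality of `F|_S` at `p` and of `f` at `p.1` are both read off `d(F ∘ Θₚ.symm)(Θₚ p)`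
  have hcritF : ∀ q, IsMCriticalPt (𝓡∂ (k + 1)) F q ↔ IsMCriticalPt (𝓡∂ (k + 1)) f q := by
    intro q
    have h1 := ((hsmooth.mdifferentiableAt (by simp)).hasMFDerivAt.add
      (hasMFDerivAt_const (I := 𝓡∂ (k + 1)) (I' := 𝓘(ℝ, ℝ)) (1 - a) q)).mfderiv
    have h2 : mfderiv (𝓡∂ (k + 1)) 𝓘(ℝ, ℝ) F q = mfderiv (𝓡∂ (k + 1)) 𝓘(ℝ, ℝ) f q :=
      h1.trans (add_zero _)
    unfold IsMCriticalPt
    rw [h2]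
    exact Iff.rfl
  have hcrit : ∀ p : ↥(f ⁻¹' Iic a),
      IsMCriticalPt (𝓡∂ (k + 1)) (F ∘ Subtype.val) p ↔ IsMCriticalPt (𝓡∂ (k + 1)) f p.1 := by
    intro p
    rw [← hcritF, IsMCriticalPt, Φ.mfderiv_comp_val_eq F p (hgsmooth.mdifferentiableAt (by simp))
      (hFΘd p), isMCriticalPt_iff_fderiv_comp_symm_eq_zero (Φ.datum p).contMDiffOn_toFun
      (Φ.datum p).contMDiffOn_symm (Φ.mem_source p) (hFsmooth.mdifferentiableAt (by simp))]
    exact Iff.rfl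
  -- at a critical point, the half-slice chart is the extended chart of `M`, and Hessians agree
  have hhess : ∀ p : ↥(f ⁻¹' Iic a), IsMCriticalPt (𝓡∂ (k + 1)) f p.1 →
      mhessian (𝓡∂ (k + 1)) (F ∘ Subtype.val) p = mhessian (𝓡∂ (k + 1)) f p.1 := by
    intro p hp
    have hlt : f p.1 < a := lt_of_le_of_ne p.2 (hreg p.1 hp)
    have hD : Φ.datum p = sublevelChartLT f a hsmooth.continuous p.1 :=
      sublevelAtlas_datum_of_lt hsmooth a hint hreg' p hlt
    have h0 : 0 < (Φ.datum p).Θ p.1 0 := by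
      rw [hD, sublevelChartLT_apply]
      have := hint p.1 p.2
      rw [ModelWithCorners.IsInteriorPoint, interior_range_modelWithCornersEuclideanHalfSpace] at this
      exact this
    have hF' : (F ∘ (Φ.datum p).Θ.symm) =ᶠ[𝓝 ((Φ.datum p).Θ p.1)]
        fun z => writtenInExtChartAt (𝓡∂ (k + 1)) 𝓘(ℝ, ℝ) p.1 f z + (1 - a) := by
      refine Filter.Eventually.of_forall fun z => ?_
      rw [hD]
      simp [writtenInExtChartAt, hFdef]
    rw [Φ.mhessian_comp_val_eq F p h0 hF', mhessian, hD, sublevelChartLT_apply]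
  refine ⟨Φ.isManifold, Φ.isSmoothEmbedding_subtype_val hk, ⟨⟨?_, fun p hp => ?_⟩, fun p hp => ?_,
    fun p hp => ?_⟩, fun p => hcrit p, fun p hp => ?_,
    fun p => isBoundaryPoint_sublevel_iff hsmooth a hint hreg' p⟩
  · -- smooth
    rw [hg]; exact hgsmooth
  · -- nondegenerate at critical points
    rw [hg] at hp ⊢
    have hp' := (hcrit p).1 hp
    rw [hhess p hp']
    exact hnondeg p.1 p.2 hp'
  · -- `= 1` and regular on the boundary `{f = a}`
    have hpa : f p.1 = a := (isBoundaryPoint_sublevel_iff hsmooth a hint hreg' p).1 hp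
    refine ⟨by simp [hpa], fun hc => ?_⟩
    rw [hg, hcrit] at hc
    exact hreg p.1 hc hpa
  · -- `< 1` inside `{f < a}`
    have hlt : f p.1 < a := (isInteriorPoint_sublevel_iff hsmooth a hint hreg' p).1 hp
    show f p.1 + (1 - a) < 1
    linarith
  · -- Morse indices
    rw [hg, morseIndex, morseIndex, hhess p hp]

end SublevelMorseLocal

end Literature.Topology.FourManifolds
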